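import Summits.BirchSwinnertonDyer.Rank1Residual.X1.RankZero
import Summits.BirchSwinnertonDyer.Rank1Residual.EisensteinPrimesSupport
import Literature.NumberTheory.EllipticCurves.Rank1Residual.GVParityLineTypeProofs
import HarnessLib

/-!
# Residual class X1 ∩ {r = 0}: the leaf lives at `p ∈ {3, 5, 7, 13}`; the sub-cell target is FOUR
# prime-indexed statements; off these primes the good-Eisenstein case is PUBLISHED (C6 ∪ C7)

HONEST FRAMING (cell `b2b-bsdres`, run/shared/lean/b2b/bsd-rank1-residual/, verbatim in every
file): the goal of the cell is to DELETE the COMBINATION-SHAPED residual classes of the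
Birch–Swinnerton-Dyer formula for ALL analytic-rank `≤ 1` elliptic curves over `ℚ` — "full BSD
formula for every rank `≤ 1` curve in class `C`" assembled STRICTLY from published theorems — so
that the rank-`≤ 1` remainder becomes exactly the CONSTRUCTION-SHAPED classes, which are TYPED
(missing-input `Prop`s), NOT attempted. This is not "finishing BSD". Sub-cell
`b2b-bsdres-eisenstein-p1` (CLASS-OWNERS.md row "X1 (r=0)"): research route; NO CLAIM BEYOND
STATED CLASSES; nothing here changes a label.

Theorems only (no definition, no named fact of our own); consumer of `EisensteinPrimesSupport.lean`
(`EisensteinPrimes.mem_of_classX1`: granted the PUBLISHED named facts `mazur_isogeny_irreducible`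
— Mazur 1978 Thm. 1 — and `primeDegreeIsogeny_jTable` — Cremona *Algorithms* §3.8 p. 82 / Mazur
1978 table p. 129 / Mazur–Swinnerton-Dyer 1974 —, `ClassX1 W p → p ∈ {3, 5, 7, 13}`) for the
sub-cell statement file `X1/RankZero.lean`:

* `Leaf.mem_primes`, `Leaf.eq_or` — a leaf pair (`ClassX1 ∧ r_an = 0`: `p > 2` good, `E[p]`
  reducible, `a_p ≡ 1 (mod p)`, type A, analytic rank `0`) has `p ∈ {3, 5, 7, 13}`;
  `not_leaf_of_not_mem`.
* `leaf_of_dvd_torsionOrder` — the most classical population IS on the leaf: a rank-`0` curve with a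
  RATIONAL POINT OF ORDER `p` at a good `p > 2` (i.e. `p ∣ #E(ℚ)_tors`; `p ∈ {3, 5, 7}`) gives a
  leaf pair (reducible, anomalous by `E(ℚ)_tors ↪ Ẽ(𝔽_p)` — x1a's `anom_of_dvd_torsionOrder` —, and
  type A since the torsion line is unramified and even — `not_gvPar_of_anom_of_nsmul_eq_zero`);
  `bsdp_of_statement_of_dvd_torsionOrder` — so "`BSD(E,5)` for every rank-`0` curve with a rational
  `5`-torsion point and good reduction at `5`" is an INSTANCE of the sub-cell's open statement, not a
  theorem of the published record at class level (per pair: x1b 770/770).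
* `statement_iff_primes` — the sub-cell TARGET `RankZero.Statement` (research route, NO CLAIM) is
  EQUIVALENT to the conjunction of its four prime-indexed instances `p = 3, 5, 7, 13`
  (X1R0-GAPMAP.md §9.3/§10: `φ = 1` — a rational `p`-torsion point in the class — at `3, 5, 7`
  only (Mazur's torsion theorem); `φ ≠ 1` even with `φ(p) = 1` at `3, 5, 7, 13`).
* `bsdp_good_red_of_not_mem` — **off `{3, 5, 7, 13}` the good-Eisenstein case of `BSD(E,p)` at
  analytic rank `≤ 1` (both ranks) is a theorem of the PUBLISHED record**: `2 < p`, good, `E[p]`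
  reducible, `r_an ≤ 1`, `p ∉ {3, 5, 7, 13}` ⟹ `BSDp W p`, from Castella–Grossi–Skinner 2025
  Thm. D (C6) ∪ Greenberg–Vatsal 2000 + Greenberg 4.1 + Kato (C7) via x1a's
  `Rank1Residual.bsdp_of_not_classX1` — the only prime this adds to rows C6/C7 beyond vacuity is
  `p = 37` (`1225h`-twists: good, reducible, never anomalous).

References: RESIDUAL-CASES.md §a.2 X1; PARTITION.md §3 rows 16–18; [Mazur1978] Thm. 1, table
p. 129; [CremonaAlgorithms1997] §3.8 p. 82; [MazurSwinnertonDyer1974] §5; [CastellaGrossiSkinner2025]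
Thm. D; [GreenbergVatsal2000] Thm. (1.3); [GreenbergLNM1716] Thm. 4.1, p. 137;
HOME/b2b-bsdres-eisenstein-p1/X1R0-GAPMAP.md §9.3, §10.
-/

set_option autoImplicit false

noncomputable section

open scoped Classical

open WeierstrassCurve Literature.NumberTheory.EllipticCurves
  Literature.NumberTheory.EllipticCurves.ModularForms
  Literature.NumberTheory.EllipticCurves.Rank1Residual
  Summit.BirchSwinnertonDyer.Rank1Residual.EisensteinPrimes

namespace Summit.BirchSwinnertonDyer.Rank1Residual.X1.RankZero

variable {W : WeierstrassCurve ℚ} [W.IsGloballyMinimal] {p : ℕ} [Fact p.Prime]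

/-- **A leaf pair has `p ∈ {3, 5, 7, 13}`** (granted Mazur 1978 Thm. 1 and the `j`-table of the
positive-genus levels; `EisensteinPrimes.mem_of_classX1`). [cite: Mazur1978, Thm. 1 and table p. 129]
[cite: CremonaAlgorithms1997, §3.8 p. 82] -/
theorem Leaf.mem_primes [W.IsElliptic] (hMaz : mazur_isogeny_irreducible)
    (hT : primeDegreeIsogeny_jTable) (h : Leaf W p) : p ∈ ({3, 5, 7, 13} : Finset ℕ) :=
  mem_of_classX1 hMaz hT W p h.classX1

/-- The same as a disjunction: a leaf prime is `3`, `5`, `7` or `13`.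
[cite: Mazur1978, Thm. 1 and table p. 129] [cite: CremonaAlgorithms1997, §3.8 p. 82] -/
theorem Leaf.eq_or [W.IsElliptic] (hMaz : mazur_isogeny_irreducible)
    (hT : primeDegreeIsogeny_jTable) (h : Leaf W p) : p = 3 ∨ p = 5 ∨ p = 7 ∨ p = 13 :=
  eq_or_of_classX1 hMaz hT W p h.classX1

/-- No leaf pair at a prime outside `{3, 5, 7, 13}`. [cite: Mazur1978, Thm. 1 and table p. 129] -/
theorem not_leaf_of_not_mem [W.IsElliptic] (hMaz : mazur_isogeny_irreducible)
    (hT : primeDegreeIsogeny_jTable) (hp : p ∉ ({3, 5, 7, 13} : Finset ℕ)) : ¬ Leaf W p :=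
  fun h ↦ hp (h.mem_primes hMaz hT)

/-- **A rank-`0` curve with a rational point of order `p` at a good `p > 2` is ON THE LEAF.**
`p ∣ #E(ℚ)_tors`, good reduction at `p > 2`, `ord_{s=1} L(E,s) = 0` ⟹ `Leaf W p`: `E[p]` is
reducible and `a_p ≡ 1 (mod p)` (`E(ℚ)_tors ↪ Ẽ(𝔽_p)`, Silverman *AEC* VII.3.1; tree
`anom_of_dvd_torsionOrder`), and the rational torsion point spans an unramified EVEN line, so the
pair is of type A (`not_gvPar_of_anom_of_nsmul_eq_zero`). E.g. `11a1@5`, every rank-`0` fibre of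
the Tate normal forms `X₁(5)`, `X₁(7)` at good `5`, `7`. [cite: SilvermanAEC2009, VII.3.1(b) and VII.3.4] -/
theorem leaf_of_dvd_torsionOrder [W.IsElliptic] (hp : 2 < p) (hgood : Good W p)
    (htors : p ∣ W.torsionOrder) (hr0 : W.analyticRank = 0) : Leaf W p := by
  have hP : p.Prime := Fact.out
  have hanom : Anom W p := anom_of_dvd_torsionOrder W p hp hgood htors
  obtain ⟨T, hT⟩ := exists_addOrderOf_eq_of_dvd_torsionOrder W p htors
  have hT0 : T ≠ 0 := by
    rintro rfl
    rw [addOrderOf_zero] at hT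
    exact hP.one_lt.ne hT
  have hpT : p • T = 0 := by rw [← hT]; exact addOrderOf_nsmul_eq_zero T
  have hng : ¬ GVPar W p := not_gvPar_of_anom_of_nsmul_eq_zero W (by omega) hanom T hT0 hpT
  exact leaf_iff.mpr ⟨hp, hanom.1, hgood, hanom, hng, hr0⟩

/-- Hence `p ∣ #E(ℚ)_tors` at a good `p > 2` with `r_an = 0` forces `p ∈ {3, 5, 7, 13}` (granted
Mazur 1978 Thm. 1 and the `j`-table; Mazur's torsion theorem would sharpen this to `{3, 5, 7}`, not
used). [cite: Mazur1978, Thm. 1 and table p. 129] -/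
theorem mem_primes_of_dvd_torsionOrder [W.IsElliptic] (hMaz : mazur_isogeny_irreducible)
    (hT : primeDegreeIsogeny_jTable) (hp : 2 < p) (hgood : Good W p)
    (htors : p ∣ W.torsionOrder) (hr0 : W.analyticRank = 0) : p ∈ ({3, 5, 7, 13} : Finset ℕ) :=
  (leaf_of_dvd_torsionOrder hp hgood htors hr0).mem_primes hMaz hT

/-- **Granted the sub-cell statement, `BSD(E,p)` for every rank-`0` curve with a rational point of
order `p` at a good `p > 2`** — the torsion population is an instance of the leaf (research route;
NO CLAIM: `Statement` is a hypothesis). [cite: SilvermanAEC2009, VII.3.1(b) and VII.3.4] -/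
theorem bsdp_of_statement_of_dvd_torsionOrder [W.IsElliptic] (hS : Statement) (hp : 2 < p)
    (hgood : Good W p) (htors : p ∣ W.torsionOrder) (hr0 : W.analyticRank = 0) : BSDp W p :=
  hS W p (leaf_of_dvd_torsionOrder hp hgood htors hr0)

/-- **The sub-cell target is four prime-indexed statements** (research route; NO CLAIM): granted
Mazur 1978 Thm. 1 and the `j`-table, `RankZero.Statement` ⟺ its instances at `p = 3, 5, 7, 13`.
Pure logic over `Leaf.eq_or`. [cite: Mazur1978, Thm. 1 and table p. 129]
[cite: CremonaAlgorithms1997, §3.8 p. 82] -/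
theorem statement_iff_primes (hMaz : mazur_isogeny_irreducible) (hT : primeDegreeIsogeny_jTable) :
    Statement ↔
      (∀ (W : WeierstrassCurve ℚ) [W.IsElliptic] [W.IsGloballyMinimal] [Fact (Nat.Prime 3)],
          Leaf W 3 → BSDp W 3) ∧
      (∀ (W : WeierstrassCurve ℚ) [W.IsElliptic] [W.IsGloballyMinimal] [Fact (Nat.Prime 5)],
          Leaf W 5 → BSDp W 5) ∧
      (∀ (W : WeierstrassCurve ℚ) [W.IsElliptic] [W.IsGloballyMinimal] [Fact (Nat.Prime 7)],
          Leaf W 7 → BSDp W 7) ∧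
      (∀ (W : WeierstrassCurve ℚ) [W.IsElliptic] [W.IsGloballyMinimal] [Fact (Nat.Prime 13)],
          Leaf W 13 → BSDp W 13) := by
  constructor
  · intro hS
    exact ⟨fun W _ _ _ hL ↦ hS W 3 hL, fun W _ _ _ hL ↦ hS W 5 hL, fun W _ _ _ hL ↦ hS W 7 hL,
      fun W _ _ _ hL ↦ hS W 13 hL⟩
  · rintro ⟨h3, h5, h7, h13⟩ W _ _ p _ hL
    rcases hL.eq_or hMaz hT with rfl | rfl | rfl | rfl
    · exact h3 W hL
    · exact h5 W hL
    · exact h7 W hL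
    · exact h13 W hL

/-- **Off `{3, 5, 7, 13}` the good-Eisenstein case of `BSD(E,p)` at analytic rank `≤ 1` is
PUBLISHED** (both ranks): for a globally minimal elliptic `W/ℚ`, a prime `p > 2` of good
reduction with `E[p]` reducible, `ord_{s=1} L(E,s) ≤ 1` and `p ∉ {3, 5, 7, 13}`, `BSD(E,p)` holds
— such a pair is never in class X1 (`mem_of_classX1`), so it lies in the covered rows C6
(Castella–Grossi–Skinner 2025 Thm. D, `¬anom`) ∪ C7 (Greenberg–Vatsal 2000 Thm. 1.3 + Greenberg
Thm. 4.1 + Kato, `r = 0 ∧ gvpar`), x1a's `Rank1Residual.bsdp_of_not_classX1`. Named facts as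
hypotheses: Mazur Thm. 1, the `j`-table, CGS Thm. D, GV Thm. 1.3, Greenberg Thm. 4.1, modularity
(×2), Gross–Zagier–Kolyvagin. (Non-vacuous exactly at `p = 37`: the `1225h` twists.)
[cite: CastellaGrossiSkinner2025, Theorem D] [cite: GreenbergVatsal2000, Thm. (1.3)]
[cite: GreenbergLNM1716, Thm. 4.1] [cite: Mazur1978, Thm. 1 and table p. 129] -/
theorem bsdp_good_red_of_not_mem (hMaz : mazur_isogeny_irreducible)
    (hT : primeDegreeIsogeny_jTable)
    (hD : CastellaGrossiSkinner2025.thmD_padicValRat_bsd_rank_le_one)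
    (hGV : GreenbergVatsal2000.thm13_charIdeal_eq_of_gvPar) (hGr : greenberg_charValue_rankZero)
    (hmod : hasEntireLFunction_rat) (hmodP : nonempty_modularParametrizationData)
    (hGZK : rank_eq_analyticRank_of_analyticRank_le_one)
    (W : WeierstrassCurve ℚ) [W.IsElliptic] [W.IsGloballyMinimal] (p : ℕ) [Fact p.Prime]
    (hp : 2 < p) (hgood : Good W p) (hred : Red W p) (hr : W.analyticRank ≤ 1)
    (hnot : p ∉ ({3, 5, 7, 13} : Finset ℕ)) : BSDp W p :=
  bsdp_of_not_classX1 hD hGV hGr hmod hmodP hGZK W p hp hgood hred hr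
    (fun hX1 ↦ hnot (mem_of_classX1 hMaz hT W p hX1))

/-- **At `p = 37` every good Eisenstein pair of analytic rank `≤ 1` satisfies `BSD(E,37)` from the
published record** (the one prime where `bsdp_good_red_of_not_mem` has content: good reducible `37`
occurs — `1225h1` — but is never anomalous, so C6 applies). [cite: CastellaGrossiSkinner2025, Theorem D]
[cite: MazurSwinnertonDyer1974, §5] -/
theorem bsdp_thirtySeven_of_good_red (hMaz : mazur_isogeny_irreducible)
    (hT : primeDegreeIsogeny_jTable)
    (hD : CastellaGrossiSkinner2025.thmD_padicValRat_bsd_rank_le_one)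
    (hGV : GreenbergVatsal2000.thm13_charIdeal_eq_of_gvPar) (hGr : greenberg_charValue_rankZero)
    (hmod : hasEntireLFunction_rat) (hmodP : nonempty_modularParametrizationData)
    (hGZK : rank_eq_analyticRank_of_analyticRank_le_one)
    (W : WeierstrassCurve ℚ) [W.IsElliptic] [W.IsGloballyMinimal] [Fact (Nat.Prime 37)]
    (hgood : Good W 37) (hred : Red W 37) (hr : W.analyticRank ≤ 1) : BSDp W 37 :=
  bsdp_good_red_of_not_mem hMaz hT hD hGV hGr hmod hmodP hGZK W 37 (by norm_num) hgood hred hr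
    (by decide)

end Summit.BirchSwinnertonDyer.Rank1Residual.X1.RankZero

end
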